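import Summits.CriticalPhenomena.Ising3DConformalLimit.Theorems.InverseSquareTelemetryTwoPointSpineComplementSplit
import Summits.CriticalPhenomena.Ising3DConformalLimit.Theorems.HelsonAxisTwoPointSpineComplementShared
import HarnessLib

/-!
# Split preview (lead c8, scratch — NOT a proposal): the three children of the recommended
# `route edit --split TwoPointSpineComplement`, declared afresh with the VERBATIM ledger signatures of items
# 4738 / 1982 / 0636 (as the gate would write them into `Theses/InverseSquareTelemetry.lean`), are delta-equal to the
# spellings consumed by the landed glue `Split.TwoPointSpineComplement_of_subs` (p150831) and
# `Shared.helsonAxis_TwoPointSpineComplement_of_subs` (p153591): both `--glue-by` candidates typecheck by `fun h₁ h₂ h₃ => glue h₁ h₂ h₃`.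
-/

namespace Summit.CriticalPhenomena.Ising3DConformalLimit.Theses.InverseSquareTelemetry

/-- child 1/3 — item stmt-CriticalPhenomena-4738 verbatim. -/
def LimitExists : Prop := ∃ (ρ : ℝ → ℝ) (S : Literature.Probability.LatticeModels.CorrFamily 3), (∀ δ ∈ Set.Ioc (0:ℝ) 1, 0 < ρ δ) ∧ Literature.Probability.LatticeModels.HasPointwiseScalingLimit (Literature.Probability.LatticeModels.criticalCorr 3) ρ S ∧ Literature.Probability.LatticeModels.IsNondegenerateTwoPoint S

/-- child 2/3 — item stmt-CriticalPhenomena-1982 verbatim. -/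
def InversionUpgradeNormalised : Prop := ∀ (ρ : ℝ → ℝ) (Δ : ℝ) (S : Literature.Probability.LatticeModels.CorrFamily 3), (∀ δ ∈ Set.Ioc (0:ℝ) 1, 0 < ρ δ) → Literature.Probability.LatticeModels.HasPointwiseScalingLimit (Literature.Probability.LatticeModels.criticalCorr 3) ρ S → (∀ n z, z ∉ Literature.Probability.LatticeModels.NonCoincident 3 n → S n z = 0) → Literature.Probability.LatticeModels.IsNondegenerateTwoPoint S → Literature.Probability.LatticeModels.IsEuclideanInvariant S → Literature.Probability.LatticeModels.IsScaleCovariant Δ S → Literature.Probability.LatticeModels.IsInversionCovariant Δ S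

/-- child 3/3 — item stmt-CriticalPhenomena-0636 verbatim. -/
def IsingEuclidUpgradeR4NonGaussian : Prop := ∀ (ρ : ℝ → ℝ) (S : Literature.Probability.LatticeModels.CorrFamily 3), (∀ δ ∈ Set.Ioc (0:ℝ) 1, 0 < ρ δ) → Literature.Probability.LatticeModels.HasPointwiseScalingLimit (Literature.Probability.LatticeModels.criticalCorr 3) ρ S → Literature.Probability.LatticeModels.IsNondegenerateTwoPoint S → Literature.Probability.LatticeModels.HasNontrivialU4 S

/-- `--glue-by Summit.CriticalPhenomena.Ising3DConformalLimit.InverseSquareTelemetryTwoPointSpineComplement.Split.TwoPointSpineComplement_of_subs`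
typechecks against the route-local spellings (delta). -/
theorem TwoPointSpineComplement_of_split :
    LimitExists → InversionUpgradeNormalised → IsingEuclidUpgradeR4NonGaussian → TwoPointSpineComplement :=
  fun hL hI hN =>
    Summit.CriticalPhenomena.Ising3DConformalLimit.InverseSquareTelemetryTwoPointSpineComplement.Split.TwoPointSpineComplement_of_subs
      hL hI hN

/-- The glue term itself has the child → crux type up to delta (no eta-expansion needed). -/
example : LimitExists → InversionUpgradeNormalised → IsingEuclidUpgradeR4NonGaussian → TwoPointSpineComplement :=
  Summit.CriticalPhenomena.Ising3DConformalLimit.InverseSquareTelemetryTwoPointSpineComplement.Split.TwoPointSpineComplement_of_subs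

/-- Exactness in the route-local spellings: (C) ↔ (0634 → 4738 ∧ 1982 ∧ 0636). -/
theorem twoPointSpineComplement_iff_split :
    TwoPointSpineComplement ↔
      (IsingEuclidUpgradeR2RotInvPowerLaw → LimitExists ∧ InversionUpgradeNormalised ∧ IsingEuclidUpgradeR4NonGaussian) :=
  Summit.CriticalPhenomena.Ising3DConformalLimit.InverseSquareTelemetryTwoPointSpineComplement.Split.twoPointSpineComplement_iff_subs

end Summit.CriticalPhenomena.Ising3DConformalLimit.Theses.InverseSquareTelemetry

namespace Summit.CriticalPhenomena.Ising3DConformalLimit.Theses.HelsonAxis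

/-- HelsonAxis copy of the crux (byte-identical decl): the same three children glue by
`Shared.helsonAxis_TwoPointSpineComplement_of_subs` (p153591). -/
example : InverseSquareTelemetry.LimitExists → InverseSquareTelemetry.InversionUpgradeNormalised →
    InverseSquareTelemetry.IsingEuclidUpgradeR4NonGaussian → HelsonAxis.TwoPointSpineComplement :=
  Summit.CriticalPhenomena.Ising3DConformalLimit.HelsonAxisTwoPointSpineComplement.Shared.helsonAxis_TwoPointSpineComplement_of_subs

end Summit.CriticalPhenomena.Ising3DConformalLimit.Theses.HelsonAxis
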